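import Summits.QuantumFields.BalabanUV.Beta.GAN24.SecondResponseReadout

/-!
# `BalabanUV.Beta.GAN24.SecondResponseZeroMode` — row G-an2-4 ∕ (CONV-C), W-slot, road «W3» (SKELETON-W3 §7.2 ∕ §8.3 (F2)), «W3-S3C*» PART 6
# module (B2): THE SECOND-RESPONSE CHANNEL OF THE BRACKET HAS ZERO FIELD–FIELD ZERO MODE IN THE SECOND-BOND ORIENTATION —
# `Σ'_{u′} Σ'_{x′} Σ'_{z′} mmRead N (K ∘ dM (K2OfK K N S M κ′ u′) N S M κ u ∘ K) x′ z′ (inl α) (inl β) = 0` at EVERY first bond `(κ, u)`,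
# for a generic packed kernel `K` (decay, site-free coarse-leg charges vanishing on multiplier legs, multiplier first legs vanishing off the
# coarse lattice), a generic local stencil family `S` carrying (S3c) (legs pair ∧ table + first leg) as HYPOTHESES and block covariance, a
# generic block-covariant vertex family `M`

NOT IN PRINT; OUR BOOKKEEPING (idle-seat kernel lemma, unit `b2b-balaban-gan24-formalise-leaf-06`, gen 9).  HONEST FRAMING (cell contract,
verbatim): «discharging `BetaPertH` makes Bałaban's UV stability UNCONDITIONAL — a real constructive-QFT result; it is NOT the continuum limit and
NOT the Clay problem.»  HONEST DEPENDENCY (verbatim): «continuum YM on T⁴ ⇐ BetaPertH ∧ nine spine estimates (0/9 proved); BetaPertH ⇐ (D1) ∧ (D4)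
∧ CAP+tail; G-an2-4 gates asym, D1 and NE2/3/4.»

WHAT ([folklore]; generic `d`, `N ≥ 1`; 0 `def`, 0 cite, 0 sorry):
* **`hasSum_bond_comp_dM_K`** — THE LOCATED MECHANISM (SKELETON-W3 §7.2 «c_q := K̃^{fm}q constant by (Q-lin)»): `HasSum (u′ ↦ Σ'_y
  (dM_{(κ′,u′)} ∘ K)(y, z)_{(inl a, inr κ)}) 0` — the bond sum goes through the column charge to the table-summed stencil (module (A) §1); its field
  second leg dies ((S3c) table + first leg); its multiplier second leg is the border's block-PERIODIC q-vector, collapsed onto the coarse lattice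
  where `K`'s mm row charge `ρL ρ″ (inr κ)` vanishes ((S2c)) — ONE absolutely convergent triple family `(u′, (q, y))`, summed both ways.
* **`hasSum_colM_K2OfK_bond`**: `HasSum (u′ ↦ Σ'_w colM (K2OfK K N S M κ′ u′) N κ u ρ w) 0` — the `w`-sum is a LEFT HALF READ-OUT (module (A′))
  of `K ∘ (dM_{(κ′,u′)} ∘ K)` (an5's `comp_assoc_tame`).
* **`hasSum_inner_resp`**: the channel identity as a `HasSum` over the bond (its `tsum_eq` is the pointwise transversal form
  `Σ'_{u′} Σ'_{x′} Σ'_{z′} … = 0`, instantiated in the step module), by module (B1)'s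
  `inner_readout_dM_of_biLoc` at `K′ := K2OfK K N S M κ′ u′` (an2's `vertexFamily_K2OfK`: bi-localised at its own bond, uniform constant);
  for the assembler also the swapped orientation's `HasSum` forms `hasSum_colM_K2OfK_pos`, **`hasSum_inner_resp_swap`** (module (B1)'s
  `inner_resp_swap_eq_zero` = its `tsum_eq`).
`zmode` forms and the W3 step instances (`K♮_j`, `S♮_j`, `M♮_j`) follow in the step module.  Asserts NO shape or value of Bałaban's tables, pins
no colour constant; discharges NOTHING of ROW W3-F2a ∕ F2b, «T2Shape» ∕ «T2SupRate», (hW, hWall); 0 wall binders; NOT «W-slot closed», NEVER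
«G-an2-4 closed»; NOT BetaPertH, NOT continuum, NOT Clay.
-/

noncomputable section

open Finset
open scoped BigOperators
open Literature.MathematicalPhysics.QuantumFieldTheory
open Literature.MathematicalPhysics.QuantumFieldTheory.Balaban1983to89
open Literature.MathematicalPhysics.QuantumFieldTheory.Balaban1983to89.Beta
open Literature.Probability.LatticeModels (Torus.proj)
open B12Sec2to5 (l1 l1_nonneg)
open ExpKernelCalculus (Site MKer BiLoc Decays VertexFamily comp shiftK Zl Zl_nonneg summable_exp_shift' tsum_exp_shift' l1_sub_triangle
  l1_sub_symm)
open OneStepResolventKernel (Fib LocStencil decays_mono biLoc_mono)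
open OneStepKernelFamily (colH vertexOfK)
open SecondOrderResponse (colM vertexOfM dM dM_apply K2OfK cK2 vertexFamily_dM vertexFamily_K2OfK)
open BalabanStepJets (locStencil_mono)
open BalabanStepJetsSucc (mmRead mmRead_inl_inl biLoc_comp_right)
open Summit.QuantumFields.BalabanUV.Beta.TameKernelCalculus (Spr Loc comp_assoc_tame)
open Summit.QuantumFields.BalabanUV.Beta.GAN24.KernelLegCharges (summable_exp_coarse summable_prod_of_biLoc)
open Summit.QuantumFields.BalabanUV.Beta.GAN24.DMBondCharges (hasSum_fibre_swap hasSum_dM_bond summable_tableSum_leg1 hasSum_tableSum_leg1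
  tableSum_periodic hasSum_collapse_left hasSum_dM_legs_ff)
open Summit.QuantumFields.BalabanUV.Beta.GAN24.HalfReadout (hasSum_halfReadout_left)
open Summit.QuantumFields.BalabanUV.Beta.GAN24.ResolventLegCharges (hasSum_sandwich_readout)
open Summit.QuantumFields.BalabanUV.Beta.GAN24.SecondResponseReadout (tsum_readout_eq tsum_prod_swap inner_readout_dM_of_biLoc)

namespace Summit.QuantumFields.BalabanUV.Beta.GAN24.SecondResponseZeroMode

variable {d : ℕ} {N : ℕ} [NeZero N]
variable {K : MKer (d + 1) (Fib d)} {C m : ℝ} {ρL ρR : Fin (d + 1) → Fib d → ℝ}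
  {S : Fin (d + 1) → Site (d + 1) → MKer (d + 1) (Fib d)} {Cs : ℝ}
  {M : Fin (d + 1) → Site (d + 1) → MKer (d + 1) (Fib d)} {CM : ℝ}

/-! ## The second-bond orientation: `K′ = K2OfK K N S M κ′ u′` runs with the summed bond -/

/-- [folklore] **THE LOCATED MECHANISM OF THE SECOND-RESPONSE CHANNEL.**  For `K` as above with, moreover, multiplier FIRST legs vanishing
off the coarse lattice, and `S` with the (S3c) table + first-leg sum rule and block covariance: for every table direction `κ′`, fibre pair
`(inl a, inr κ)` and second site `z`, `HasSum (u′ ↦ Σ'_y (dM K N S M κ′ u′ ∘ K)(y, z)_{(inl a, inr κ)}) 0` — the bond sum goes through the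
column charge to the table-summed stencil (module (A) §1), whose field second leg dies on the first-leg sum ((S3c)) and whose multiplier second
leg is a block-PERIODIC scalar (the border's q-vector) meeting `K`'s mm row charge `ρL ρ″ (inr κ) = 0` on the coarse lattice ((S2c)). -/
theorem hasSum_bond_comp_dM_K (hK : Decays K C m) (hm : 0 < m)
    (hrow : ∀ α f y, HasSum (fun x' : Site (d + 1) => K ((N : ℤ) • x') y (Sum.inr α) f) (ρL α f))
    (hcol : ∀ β g w, HasSum (fun z' : Site (d + 1) => K w ((N : ℤ) • z') g (Sum.inr β)) (ρR β g))
    (hL0 : ∀ α μ, ρL α (Sum.inr μ) = 0) (hR0 : ∀ β μ, ρR β (Sum.inr μ) = 0)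
    (hoffL : ∀ (x z : Site (d + 1)) (ρ : Fin (d + 1)) (b : Fib d), Torus.proj N x ≠ 0 → K x z (Sum.inr ρ) b = 0)
    (hS : LocStencil S Cs m)
    (hS1 : ∀ (κ : Fin (d + 1)) (q : Site (d + 1)) (a b : Fin (d + 1)),
      HasSum (fun tp : Site (d + 1) × Site (d + 1) => S κ tp.1 tp.2 q (Sum.inl a) (Sum.inl b)) 0)
    (hSt : ∀ (κ : Fin (d + 1)) (u s : Site (d + 1)), S κ (u + (N : ℤ) • s) = shiftK (-((N : ℤ) • s)) (S κ u))
    (hM : VertexFamily M N CM m) (κ' : Fin (d + 1)) (z : Site (d + 1)) (a κ : Fin (d + 1)) :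
    HasSum (fun u' : Site (d + 1) => ∑' y : Site (d + 1), comp (dM K N S M κ' u') K y z (Sum.inl a) (Sum.inr κ)) 0 := by
  classical
  have hN : 1 ≤ N := Nat.one_le_iff_ne_zero.2 (NeZero.ne N)
  have hC : 0 ≤ C := hK.nonneg (Sum.inl 0)
  have hm2 : 0 < m / 2 := half_pos hm
  have hm4 : 0 < m / 4 := by positivity
  -- colM bond masses of `K` vanish ((S2c), from the column charges)
  have hK0 : ∀ (μ ρ : Fin (d + 1)) (w : Site (d + 1)), HasSum (fun y : Site (d + 1) => colM K N μ y ρ w) 0 :=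
    fun μ ρ w => by simpa only [hR0, colM] using hcol μ (Sum.inr ρ) ((N : ℤ) • w)
  -- the bond family of derivatives, uniformly bi-localised at its own bond
  have hV := vertexFamily_dM (N := N) hK hC hS hM hm le_rfl
  set CV : ℝ := (d + 1 : ℕ) * (C * Cs * Zl (d + 1) (m / 2)) + (d + 1 : ℕ) * (C * CM * Zl (d + 1) (m / 2)) with hCV
  have hCV0 : 0 ≤ CV := (hV 0 0).nonneg (Sum.inl 0)
  set A : ℝ := (Fintype.card (Fib d) : ℝ) * (CV * C) with hA
  have hA0 : 0 ≤ A := by positivity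
  -- the triple family `(u′, (q, y))` and its majorant
  have hGle : ∀ s : Site (d + 1) × (Site (d + 1) × Site (d + 1)),
      |∑ e, dM K N S M κ' s.1 s.2.2 s.2.1 (Sum.inl a) e * K s.2.1 z e (Sum.inr κ)|
        ≤ (A * Real.exp (-(m / 4) * l1 ((N : ℤ) • s.1 - z))) *
          (Real.exp (-(m / 4) * l1 (s.2.1 - (N : ℤ) • s.1)) * Real.exp (-(m / 2) * l1 (s.2.2 - (N : ℤ) • s.1))) := by
    rintro ⟨u', q, y⟩
    have htri : l1 ((N : ℤ) • u' - z) ≤ l1 (q - (N : ℤ) • u') + l1 (q - z) := by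
      have h := l1_sub_triangle ((N : ℤ) • u') q z
      rwa [l1_sub_symm ((N : ℤ) • u') q] at h
    have hterm : ∀ e, |dM K N S M κ' u' y q (Sum.inl a) e * K q z e (Sum.inr κ)|
        ≤ (CV * C) * (Real.exp (-(m / 4) * l1 ((N : ℤ) • u' - z)) *
          (Real.exp (-(m / 4) * l1 (q - (N : ℤ) • u')) * Real.exp (-(m / 2) * l1 (y - (N : ℤ) • u')))) := by
      intro e
      rw [abs_mul]
      have e1 := hV κ' u' y q (Sum.inl a) e
      have e2 := hK q z e (Sum.inr κ)
      have hprod := mul_le_mul e1 e2 (abs_nonneg _) ((abs_nonneg _).trans e1)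
      refine hprod.trans ?_
      have hexp : Real.exp (-(m / 2) * (l1 (y - (N : ℤ) • u') + l1 (q - (N : ℤ) • u'))) * Real.exp (-m * l1 (q - z))
          ≤ Real.exp (-(m / 4) * l1 ((N : ℤ) • u' - z)) *
            (Real.exp (-(m / 4) * l1 (q - (N : ℤ) • u')) * Real.exp (-(m / 2) * l1 (y - (N : ℤ) • u'))) := by
        rw [← Real.exp_add, ← Real.exp_add, ← Real.exp_add, Real.exp_le_exp]
        nlinarith [l1_nonneg (q - (N : ℤ) • u'), l1_nonneg (q - z), l1_nonneg (y - (N : ℤ) • u')]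
      calc CV * Real.exp (-(m / 2) * (l1 (y - (N : ℤ) • u') + l1 (q - (N : ℤ) • u'))) * (C * Real.exp (-m * l1 (q - z)))
          = (CV * C) * (Real.exp (-(m / 2) * (l1 (y - (N : ℤ) • u') + l1 (q - (N : ℤ) • u'))) * Real.exp (-m * l1 (q - z))) := by
            ring
        _ ≤ _ := mul_le_mul_of_nonneg_left hexp (mul_nonneg hCV0 hC)
    calc |∑ e, dM K N S M κ' u' y q (Sum.inl a) e * K q z e (Sum.inr κ)|
        ≤ ∑ e, |dM K N S M κ' u' y q (Sum.inl a) e * K q z e (Sum.inr κ)| := Finset.abs_sum_le_sum_abs _ _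
      _ ≤ ∑ _e : Fib d, (CV * C) * (Real.exp (-(m / 4) * l1 ((N : ℤ) • u' - z)) *
          (Real.exp (-(m / 4) * l1 (q - (N : ℤ) • u')) * Real.exp (-(m / 2) * l1 (y - (N : ℤ) • u')))) :=
          Finset.sum_le_sum fun e _ => hterm e
      _ = _ := by simp only [Finset.sum_const, Finset.card_univ, nsmul_eq_mul, hA]; ring
  have hM0 : 0 ≤ fun s : Site (d + 1) × (Site (d + 1) × Site (d + 1)) =>
      (A * Real.exp (-(m / 4) * l1 ((N : ℤ) • s.1 - z))) *
        (Real.exp (-(m / 4) * l1 (s.2.1 - (N : ℤ) • s.1)) * Real.exp (-(m / 2) * l1 (s.2.2 - (N : ℤ) • s.1))) :=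
    fun s => by positivity
  have hMfib : ∀ u' : Site (d + 1), HasSum (fun qy : Site (d + 1) × Site (d + 1) =>
      (A * Real.exp (-(m / 4) * l1 ((N : ℤ) • u' - z))) *
        (Real.exp (-(m / 4) * l1 (qy.1 - (N : ℤ) • u')) * Real.exp (-(m / 2) * l1 (qy.2 - (N : ℤ) • u'))))
      ((A * Real.exp (-(m / 4) * l1 ((N : ℤ) • u' - z))) * (Zl (d + 1) (m / 4) * Zl (d + 1) (m / 2))) := by
    intro u'
    have hq : HasSum (fun q : Site (d + 1) => Real.exp (-(m / 4) * l1 (q - (N : ℤ) • u'))) (Zl (d + 1) (m / 4)) := by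
      rw [← tsum_exp_shift' ((N : ℤ) • u')]
      exact (summable_exp_shift' hm4 _).hasSum
    have hy : HasSum (fun y : Site (d + 1) => Real.exp (-(m / 2) * l1 (y - (N : ℤ) • u'))) (Zl (d + 1) (m / 2)) := by
      rw [← tsum_exp_shift' ((N : ℤ) • u')]
      exact (summable_exp_shift' hm2 _).hasSum
    exact (hq.mul hy (hq.summable.mul_of_nonneg hy.summable (fun _ => (Real.exp_pos _).le) (fun _ => (Real.exp_pos _).le))).mul_left _
  have hMsum : Summable fun u' : Site (d + 1) => ∑' qy : Site (d + 1) × Site (d + 1),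
      (A * Real.exp (-(m / 4) * l1 ((N : ℤ) • u' - z))) *
        (Real.exp (-(m / 4) * l1 (qy.1 - (N : ℤ) • u')) * Real.exp (-(m / 2) * l1 (qy.2 - (N : ℤ) • u'))) := by
    have e : (fun u' : Site (d + 1) => ∑' qy : Site (d + 1) × Site (d + 1),
        (A * Real.exp (-(m / 4) * l1 ((N : ℤ) • u' - z))) *
          (Real.exp (-(m / 4) * l1 (qy.1 - (N : ℤ) • u')) * Real.exp (-(m / 2) * l1 (qy.2 - (N : ℤ) • u'))))
        = fun u' => (A * (Zl (d + 1) (m / 4) * Zl (d + 1) (m / 2))) * Real.exp (-(m / 4) * l1 ((N : ℤ) • u' - z)) := by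
      funext u'
      rw [(hMfib u').tsum_eq]
      ring
    rw [e]
    exact (summable_exp_coarse (d := d) hN hm4 z).mul_left _
  have hmaj := (summable_prod_of_nonneg hM0).2 ⟨fun u' => (hMfib u').summable, hMsum⟩
  have hGA : Summable fun s : Site (d + 1) × (Site (d + 1) × Site (d + 1)) =>
      ∑ e, dM K N S M κ' s.1 s.2.2 s.2.1 (Sum.inl a) e * K s.2.1 z e (Sum.inr κ) :=
    Summable.of_norm_bounded hmaj (fun s => by rw [Real.norm_eq_abs]; exact hGle s)
  -- fibres over the bond `u′` at fixed `(q, y)`: the table-bond sum through the column charge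
  have hfib : ∀ qy : Site (d + 1) × Site (d + 1), HasSum (fun u' : Site (d + 1) =>
      ∑ e, dM K N S M κ' u' qy.2 qy.1 (Sum.inl a) e * K qy.1 z e (Sum.inr κ))
      (∑ e, (∑ κ'' : Fin (d + 1), ρR κ' (Sum.inl κ'') * ∑' t : Site (d + 1), S κ'' t qy.2 qy.1 (Sum.inl a) e) * K qy.1 z e (Sum.inr κ)) :=
    fun qy => hasSum_sum fun e _ => (hasSum_dM_bond hK hm κ' (hcol κ') hK0 hS hM qy.2 qy.1 (Sum.inl a) e).mul_right _
  have hswap := hasSum_fibre_swap (G := fun p : (Site (d + 1) × Site (d + 1)) × Site (d + 1) =>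
      ∑ e, dM K N S M κ' p.2 p.1.2 p.1.1 (Sum.inl a) e * K p.1.1 z e (Sum.inr κ)) hGA.prod_symm hfib
  -- the value: `Σ'_{(q,y)}` of the fibre sums vanishes
  have hgs : Summable fun qy : Site (d + 1) × Site (d + 1) =>
      ∑ e, (∑ κ'' : Fin (d + 1), ρR κ' (Sum.inl κ'') * ∑' t : Site (d + 1), S κ'' t qy.2 qy.1 (Sum.inl a) e) * K qy.1 z e (Sum.inr κ) := by
    refine (hGA.prod_symm.prod).congr fun qy => ?_
    exact (hfib qy).tsum_eq
  -- the block-periodic q-vectors of the table-summed stencil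
  have hΨ : ∀ (κ'' ρ'' : Fin (d + 1)) (q s : Site (d + 1)),
      (∑' y : Site (d + 1), ∑' t : Site (d + 1), S κ'' t y (q + (N : ℤ) • s) (Sum.inl a) (Sum.inr ρ''))
        = ∑' y : Site (d + 1), ∑' t : Site (d + 1), S κ'' t y q (Sum.inl a) (Sum.inr ρ'') := by
    intro κ'' ρ'' q s
    rw [← (Equiv.addRight ((N : ℤ) • s)).tsum_eq (fun y => ∑' t : Site (d + 1), S κ'' t y (q + (N : ℤ) • s) (Sum.inl a) (Sum.inr ρ''))]
    refine tsum_congr fun y => ?_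
    simp only [Equiv.coe_addRight]
    exact tableSum_periodic hSt κ'' y q (Sum.inl a) (Sum.inr ρ'') s
  have hinner : ∀ q : Site (d + 1), (∑' y : Site (d + 1),
      ∑ e, (∑ κ'' : Fin (d + 1), ρR κ' (Sum.inl κ'') * ∑' t : Site (d + 1), S κ'' t y q (Sum.inl a) e) * K q z e (Sum.inr κ))
      = ∑ ρ'' : Fin (d + 1), ∑ κ'' : Fin (d + 1), ρR κ' (Sum.inl κ'') *
          ((∑' y : Site (d + 1), ∑' t : Site (d + 1), S κ'' t y q (Sum.inl a) (Sum.inr ρ'')) * K q z (Sum.inr ρ'') (Sum.inr κ)) := by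
    intro q
    have hs : ∀ (e : Fib d) (κ'' : Fin (d + 1)), Summable fun y : Site (d + 1) =>
        ρR κ' (Sum.inl κ'') * (∑' t : Site (d + 1), S κ'' t y q (Sum.inl a) e) * K q z e (Sum.inr κ) :=
      fun e κ'' => ((summable_tableSum_leg1 hS hm κ'' q (Sum.inl a) e).mul_left _).mul_right _
    have e1 : ∀ y : Site (d + 1),
        ∑ e, (∑ κ'' : Fin (d + 1), ρR κ' (Sum.inl κ'') * ∑' t : Site (d + 1), S κ'' t y q (Sum.inl a) e) * K q z e (Sum.inr κ)
          = ∑ e, ∑ κ'' : Fin (d + 1), ρR κ' (Sum.inl κ'') * (∑' t : Site (d + 1), S κ'' t y q (Sum.inl a) e) * K q z e (Sum.inr κ) :=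
      fun y => Finset.sum_congr rfl fun e _ => Finset.sum_mul _ _ _
    simp_rw [e1]
    rw [Summable.tsum_finsetSum (fun e _ => summable_sum fun κ'' _ => hs e κ'')]
    have e2 : ∀ e, ∑' y : Site (d + 1), ∑ κ'' : Fin (d + 1),
        ρR κ' (Sum.inl κ'') * (∑' t : Site (d + 1), S κ'' t y q (Sum.inl a) e) * K q z e (Sum.inr κ)
          = ∑ κ'' : Fin (d + 1), ρR κ' (Sum.inl κ'') *
              ((∑' y : Site (d + 1), ∑' t : Site (d + 1), S κ'' t y q (Sum.inl a) e) * K q z e (Sum.inr κ)) := by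
      intro e
      rw [Summable.tsum_finsetSum (fun κ'' _ => hs e κ'')]
      refine Finset.sum_congr rfl fun κ'' _ => ?_
      rw [tsum_mul_right, tsum_mul_left, mul_assoc]
    simp_rw [e2]
    rw [Fintype.sum_sum_type]
    have hl : ∑ b : Fin (d + 1), ∑ κ'' : Fin (d + 1), ρR κ' (Sum.inl κ'') *
        ((∑' y : Site (d + 1), ∑' t : Site (d + 1), S κ'' t y q (Sum.inl a) (Sum.inl b)) * K q z (Sum.inl b) (Sum.inr κ)) = 0 :=
      Finset.sum_eq_zero fun b _ => Finset.sum_eq_zero fun κ'' _ => by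
        rw [(hasSum_tableSum_leg1 (hS1 κ'' q a b)).tsum_eq, zero_mul, mul_zero]
    rw [hl, zero_add]
  have hφ : ∀ (ρ'' κ'' : Fin (d + 1)), HasSum (fun q : Site (d + 1) =>
      (∑' y : Site (d + 1), ∑' t : Site (d + 1), S κ'' t y q (Sum.inl a) (Sum.inr ρ'')) * K q z (Sum.inr ρ'') (Sum.inr κ)) 0 := by
    intro ρ'' κ''
    have h := hasSum_collapse_left (N := N) (Ψ := fun q => ∑' y : Site (d + 1), ∑' t : Site (d + 1), S κ'' t y q (Sum.inl a) (Sum.inr ρ''))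
      ρ'' (hrow ρ'') (fun x z' b hx => hoffL x z' ρ'' b hx) (hΨ κ'' ρ'') z (Sum.inr κ)
    rw [hL0, mul_zero] at h
    exact h
  have htot : (∑' qy : Site (d + 1) × Site (d + 1),
      ∑ e, (∑ κ'' : Fin (d + 1), ρR κ' (Sum.inl κ'') * ∑' t : Site (d + 1), S κ'' t qy.2 qy.1 (Sum.inl a) e) * K qy.1 z e (Sum.inr κ)) = 0 := by
    rw [hgs.tsum_prod]
    simp_rw [hinner]
    rw [Summable.tsum_finsetSum (fun ρ'' _ => summable_sum fun κ'' _ => (hφ ρ'' κ'').summable.mul_left _)]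
    refine Finset.sum_eq_zero fun ρ'' _ => ?_
    rw [Summable.tsum_finsetSum (fun κ'' _ => (hφ ρ'' κ'').summable.mul_left _)]
    refine Finset.sum_eq_zero fun κ'' _ => ?_
    rw [tsum_mul_left, (hφ ρ'' κ'').tsum_eq, mul_zero]
  rw [htot] at hswap
  -- identify the target family with the `(q, y)`-sums of the triple family
  refine hswap.congr_fun fun u' => ?_
  have hfu : Summable fun qy : Site (d + 1) × Site (d + 1) =>
      ∑ e, dM K N S M κ' u' qy.2 qy.1 (Sum.inl a) e * K qy.1 z e (Sum.inr κ) := hGA.prod_factor u'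
  show (∑' y : Site (d + 1), comp (dM K N S M κ' u') K y z (Sum.inl a) (Sum.inr κ))
    = ∑' qy : Site (d + 1) × Site (d + 1), ∑ e, dM K N S M κ' u' qy.2 qy.1 (Sum.inl a) e * K qy.1 z e (Sum.inr κ)
  rw [hfu.tsum_prod, tsum_prod_swap hfu]
  simp only [comp]

/-- [folklore] **BOND SERIES OF THE MULTIPLIER-COLUMN POSITION MASSES OF THE RUNNING `K2OfK`**: for every fixed bond `(κ, u)` and `ρ`,
`HasSum (u′ ↦ Σ'_w colM (K2OfK K N S M κ′ u′) N κ u ρ w) 0` — `K2OfK … κ′ u′ = −K ∘ dM_{(κ′,u′)} ∘ K`; the `w`-sum is a LEFT HALF READ-OUT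
(module (A′)) leaving `−Σ_a ρL ρ (inl a) · Σ'_y (dM_{(κ′,u′)} ∘ K)(y, N•u)_{(inl a, inr κ)}`, whose bond series vanishes termwise in `a`
(`hasSum_bond_comp_dM_K`). -/
theorem hasSum_colM_K2OfK_bond (hK : Decays K C m) (hm : 0 < m)
    (hrow : ∀ α f y, HasSum (fun x' : Site (d + 1) => K ((N : ℤ) • x') y (Sum.inr α) f) (ρL α f))
    (hcol : ∀ β g w, HasSum (fun z' : Site (d + 1) => K w ((N : ℤ) • z') g (Sum.inr β)) (ρR β g))
    (hL0 : ∀ α μ, ρL α (Sum.inr μ) = 0) (hR0 : ∀ β μ, ρR β (Sum.inr μ) = 0)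
    (hoffL : ∀ (x z : Site (d + 1)) (ρ : Fin (d + 1)) (b : Fib d), Torus.proj N x ≠ 0 → K x z (Sum.inr ρ) b = 0)
    (hS : LocStencil S Cs m)
    (hS1 : ∀ (κ : Fin (d + 1)) (q : Site (d + 1)) (a b : Fin (d + 1)),
      HasSum (fun tp : Site (d + 1) × Site (d + 1) => S κ tp.1 tp.2 q (Sum.inl a) (Sum.inl b)) 0)
    (hSt : ∀ (κ : Fin (d + 1)) (u s : Site (d + 1)), S κ (u + (N : ℤ) • s) = shiftK (-((N : ℤ) • s)) (S κ u))
    (hM : VertexFamily M N CM m) (κ : Fin (d + 1)) (u : Site (d + 1)) (κ' ρ : Fin (d + 1)) :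
    HasSum (fun u' : Site (d + 1) => ∑' w : Site (d + 1), colM (K2OfK K N S M κ' u') N κ u ρ w) 0 := by
  have hC : 0 ≤ C := hK.nonneg (Sum.inl 0)
  have hm2 : 0 < m / 2 := half_pos hm
  have hm4 : 0 < m / 4 := by positivity
  have hKs : Spr K := ⟨C, m, hm, hK⟩
  have hK2d : Decays K C (m / 2) := decays_mono hK hC le_rfl (by linarith)
  have hV := vertexFamily_dM (N := N) hK hC hS hM hm le_rfl
  -- per bond: the `w`-sum is a left half read-out of `K ∘ (dM_{u′} ∘ K)`
  have hper : ∀ u' : Site (d + 1), (∑' w : Site (d + 1), colM (K2OfK K N S M κ' u') N κ u ρ w)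
      = -(∑ a : Fin (d + 1), ρL ρ (Sum.inl a) *
          ∑' y : Site (d + 1), comp (dM K N S M κ' u') K y ((N : ℤ) • u) (Sum.inl a) (Sum.inr κ)) := by
    intro u'
    have hD : Loc (dM K N S M κ' u') := ⟨_, _, _, _, hm2, hV κ' u'⟩
    have hDK : BiLoc (comp (dM K N S M κ' u') K) ((N : ℤ) • u') ((N : ℤ) • u') _ (m / 4) :=
      biLoc_comp_right (hV κ' u') hK2d hm4.le (by linarith)
    have hslice : ∀ f, Summable fun y : Site (d + 1) => comp (dM K N S M κ' u') K y ((N : ℤ) • u) f (Sum.inr κ) :=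
      fun f => (summable_prod_of_biLoc hDK hm4 f (Sum.inr κ)).prod_symm.prod_factor ((N : ℤ) • u)
    have hhalf := hasSum_halfReadout_left hK hm ρ (hrow ρ) ((N : ℤ) • u) (Sum.inr κ) hslice
    have hassoc : comp (comp K (dM K N S M κ' u')) K = comp K (comp (dM K N S M κ' u') K) :=
      (comp_assoc_tame hKs.tame hD.tame hKs.tame).symm
    have e1 : (fun w : Site (d + 1) => colM (K2OfK K N S M κ' u') N κ u ρ w)
        = fun w => -(comp K (comp (dM K N S M κ' u') K) ((N : ℤ) • w) ((N : ℤ) • u) (Sum.inr ρ) (Sum.inr κ)) := by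
      funext w
      simp only [colM, K2OfK, hassoc]
    rw [e1, tsum_neg, hhalf.tsum_eq]
    congr 1
    have hs : ∀ f, Summable fun y : Site (d + 1) => ρL ρ f * comp (dM K N S M κ' u') K y ((N : ℤ) • u) f (Sum.inr κ) :=
      fun f => (hslice f).mul_left _
    rw [Summable.tsum_finsetSum (fun f _ => hs f), Fintype.sum_sum_type]
    have hr : ∑ μ : Fin (d + 1), ∑' y : Site (d + 1),
        ρL ρ (Sum.inr μ) * comp (dM K N S M κ' u') K y ((N : ℤ) • u) (Sum.inr μ) (Sum.inr κ) = 0 :=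
      Finset.sum_eq_zero fun μ _ => by simp only [hL0, zero_mul, tsum_zero]
    rw [hr, add_zero]
    exact Finset.sum_congr rfl fun a _ => tsum_mul_left
  simp_rw [hper]
  have h := (hasSum_sum (s := (Finset.univ : Finset (Fin (d + 1)))) fun a _ =>
    (hasSum_bond_comp_dM_K hK hm hrow hcol hL0 hR0 hoffL hS hS1 hSt hM κ' ((N : ℤ) • u) a κ).mul_left (ρL ρ (Sum.inl a))).neg
  simp only [mul_zero, Finset.sum_const_zero, neg_zero] at h
  exact h

/-- [folklore] **THE SECOND-RESPONSE CHANNEL, second-bond orientation — `HasSum` OVER THE BOND of the transversal inner sums** (the form an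
assembler adds up): under the hypotheses below, `HasSum (u′ ↦ Σ'_{x′} Σ'_{z′} mmRead N (K ∘ dM (K2OfK K N S M κ′ u′) N S M κ u ∘ K) x′ z′ (inl α) (inl β)) 0`. -/
theorem hasSum_inner_resp (hK : Decays K C m) (hm : 0 < m)
    (hrow : ∀ α f y, HasSum (fun x' : Site (d + 1) => K ((N : ℤ) • x') y (Sum.inr α) f) (ρL α f))
    (hcol : ∀ β g w, HasSum (fun z' : Site (d + 1) => K w ((N : ℤ) • z') g (Sum.inr β)) (ρR β g))
    (hL0 : ∀ α μ, ρL α (Sum.inr μ) = 0) (hR0 : ∀ β μ, ρR β (Sum.inr μ) = 0)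
    (hoffL : ∀ (x z : Site (d + 1)) (ρ : Fin (d + 1)) (b : Fib d), Torus.proj N x ≠ 0 → K x z (Sum.inr ρ) b = 0)
    (hS : LocStencil S Cs m)
    (hS0 : ∀ (κ : Fin (d + 1)) (t : Site (d + 1)) (a b : Fin (d + 1)),
      HasSum (fun vp : Site (d + 1) × Site (d + 1) => S κ t vp.1 vp.2 (Sum.inl a) (Sum.inl b)) 0)
    (hS1 : ∀ (κ : Fin (d + 1)) (q : Site (d + 1)) (a b : Fin (d + 1)),
      HasSum (fun tp : Site (d + 1) × Site (d + 1) => S κ tp.1 tp.2 q (Sum.inl a) (Sum.inl b)) 0)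
    (hSt : ∀ (κ : Fin (d + 1)) (u s : Site (d + 1)), S κ (u + (N : ℤ) • s) = shiftK (-((N : ℤ) • s)) (S κ u))
    (hM : VertexFamily M N CM m) (hMt : ∀ (ρ : Fin (d + 1)) (w t : Site (d + 1)), M ρ (w + t) = shiftK (-((N : ℤ) • t)) (M ρ w))
    (κ : Fin (d + 1)) (u : Site (d + 1)) (κ' α β : Fin (d + 1)) :
    HasSum (fun u' : Site (d + 1) => ∑' x', ∑' z', mmRead N (comp (comp K (dM (K2OfK K N S M κ' u') N S M κ u)) K) x' z'
      (Sum.inl α) (Sum.inl β)) 0 := by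
  have hC : 0 ≤ C := hK.nonneg (Sum.inl 0)
  have hCs : 0 ≤ Cs := (hS 0 0).nonneg (Sum.inl 0)
  have hCM : 0 ≤ CM := (hM 0 0).nonneg (Sum.inl 0)
  have hm8 : 0 < m / 8 := by positivity
  have hK2v := vertexFamily_K2OfK hK hC hm hS hM
  have hK8 : Decays K C (m / 8) := decays_mono hK hC le_rfl (by linarith)
  have hS8 : LocStencil S Cs (m / 8) := locStencil_mono hS hCs (by linarith)
  have hM8 : VertexFamily M N CM (m / 8) := fun ρ w => biLoc_mono (hM ρ w) hCM (by linarith)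
  have hval : ∀ u' : Site (d + 1),
      (∑' x', ∑' z', mmRead N (comp (comp K (dM (K2OfK K N S M κ' u') N S M κ u)) K) x' z' (Sum.inl α) (Sum.inl β))
        = ∑ a : Fin (d + 1), ∑ b : Fin (d + 1), ρL α (Sum.inl a) * ρR β (Sum.inl b) *
            ∑ ρ : Fin (d + 1), (∑' w : Site (d + 1), colM (K2OfK K N S M κ' u') N κ u ρ w) *
              ∑' vp : Site (d + 1) × Site (d + 1), M ρ 0 vp.1 vp.2 (Sum.inl a) (Sum.inl b) :=
    fun u' => inner_readout_dM_of_biLoc hK8 hm8 hrow hcol hL0 hR0 hS8 hS0 hM8 hMt (hK2v κ' u') κ u α β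
  have hcm : ∀ ρ : Fin (d + 1), HasSum (fun u' : Site (d + 1) => ∑' w : Site (d + 1), colM (K2OfK K N S M κ' u') N κ u ρ w) 0 :=
    fun ρ => hasSum_colM_K2OfK_bond hK hm hrow hcol hL0 hR0 hoffL hS hS1 hSt hM κ u κ' ρ
  have h := hasSum_sum (s := (Finset.univ : Finset (Fin (d + 1)))) fun a _ =>
    hasSum_sum (s := (Finset.univ : Finset (Fin (d + 1)))) fun b _ =>
      (hasSum_sum (s := (Finset.univ : Finset (Fin (d + 1)))) fun ρ _ =>
        (hcm ρ).mul_right (∑' vp : Site (d + 1) × Site (d + 1), M ρ 0 vp.1 vp.2 (Sum.inl a) (Sum.inl b))).mul_left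
          (ρL α (Sum.inl a) * ρR β (Sum.inl b))
  simp only [zero_mul, Finset.sum_const_zero, mul_zero] at h
  exact h.congr_fun fun u' => (hval u').symm ▸ rfl

/-- [folklore] **BOND SERIES OF THE MULTIPLIER-COLUMN BOND MASSES OF THE FIXED `K2OfK`** (the swapped orientation's ingredient, exported for the
assembler): `HasSum (u′ ↦ Σ'_w colM (K2OfK K N S M κ u) N κ′ u′ ρ w) 0` — gen 8's sandwich read-out of `dM_{(κ,u)}` on two multiplier charges is ff
charges × `dM_{(κ,u)}` on two constant kernel legs = 0 (module (A) `hasSum_dM_legs_ff`). -/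
theorem hasSum_colM_K2OfK_pos (hK : Decays K C m) (hm : 0 < m)
    (hrow : ∀ α f y, HasSum (fun x' : Site (d + 1) => K ((N : ℤ) • x') y (Sum.inr α) f) (ρL α f))
    (hcol : ∀ β g w, HasSum (fun z' : Site (d + 1) => K w ((N : ℤ) • z') g (Sum.inr β)) (ρR β g))
    (hL0 : ∀ α μ, ρL α (Sum.inr μ) = 0) (hR0 : ∀ β μ, ρR β (Sum.inr μ) = 0) (hS : LocStencil S Cs m)
    (hS0 : ∀ (κ : Fin (d + 1)) (t : Site (d + 1)) (a b : Fin (d + 1)),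
      HasSum (fun vp : Site (d + 1) × Site (d + 1) => S κ t vp.1 vp.2 (Sum.inl a) (Sum.inl b)) 0)
    (hM : VertexFamily M N CM m) (hMt : ∀ (ρ : Fin (d + 1)) (w t : Site (d + 1)), M ρ (w + t) = shiftK (-((N : ℤ) • t)) (M ρ w))
    (κ : Fin (d + 1)) (u : Site (d + 1)) (κ' ρ : Fin (d + 1)) :
    HasSum (fun u' : Site (d + 1) => ∑' w : Site (d + 1), colM (K2OfK K N S M κ u) N κ' u' ρ w) 0 := by
  have hC : 0 ≤ C := hK.nonneg (Sum.inl 0)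
  have hK0' : ∀ (μ ρ : Fin (d + 1)) (y : Site (d + 1)), HasSum (fun w : Site (d + 1) => colM K N μ y ρ w) 0 :=
    fun μ ρ y => by simpa only [hL0, colM] using hrow ρ (Sum.inr μ) ((N : ℤ) • y)
  have hVb := (vertexFamily_dM (N := N) hK hC hS hM hm le_rfl) κ u
  have hsand := hasSum_sandwich_readout hK hm hVb (half_pos hm) ρ κ' (hrow ρ) (hcol κ')
  have hR : (∑' yw : Site (d + 1) × Site (d + 1), ∑ f, ∑ g, ρL ρ f * dM K N S M κ u yw.1 yw.2 f g * ρR κ' g) = 0 := by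
    rw [tsum_readout_eq (hL0 ρ) (hR0 κ') (fun f g => summable_prod_of_biLoc hVb (half_pos hm) f g)]
    refine Finset.sum_eq_zero fun a _ => Finset.sum_eq_zero fun b _ => ?_
    rw [(hasSum_dM_legs_ff hK hm hK0' hS hS0 hM hMt κ u a b).tsum_eq, mul_zero]
  rw [hR] at hsand
  have hG : HasSum (fun wu : Site (d + 1) × Site (d + 1) => colM (K2OfK K N S M κ u) N κ' wu.2 ρ wu.1) 0 := by
    have h := hsand.neg
    rw [neg_zero] at h
    exact h.congr_fun fun wu => by simp only [colM, K2OfK]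
  have h := hasSum_fibre_swap hG.summable (fun w => (hG.summable.prod_factor w).hasSum)
  rwa [← hG.summable.tsum_prod, hG.tsum_eq] at h

/-- [folklore] **THE SECOND-RESPONSE CHANNEL, first-bond (swapped) orientation — `HasSum` OVER THE BOND** (module (B1)'s
`inner_resp_swap_eq_zero` in the form an assembler adds up). -/
theorem hasSum_inner_resp_swap (hK : Decays K C m) (hm : 0 < m)
    (hrow : ∀ α f y, HasSum (fun x' : Site (d + 1) => K ((N : ℤ) • x') y (Sum.inr α) f) (ρL α f))
    (hcol : ∀ β g w, HasSum (fun z' : Site (d + 1) => K w ((N : ℤ) • z') g (Sum.inr β)) (ρR β g))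
    (hL0 : ∀ α μ, ρL α (Sum.inr μ) = 0) (hR0 : ∀ β μ, ρR β (Sum.inr μ) = 0) (hS : LocStencil S Cs m)
    (hS0 : ∀ (κ : Fin (d + 1)) (t : Site (d + 1)) (a b : Fin (d + 1)),
      HasSum (fun vp : Site (d + 1) × Site (d + 1) => S κ t vp.1 vp.2 (Sum.inl a) (Sum.inl b)) 0)
    (hM : VertexFamily M N CM m) (hMt : ∀ (ρ : Fin (d + 1)) (w t : Site (d + 1)), M ρ (w + t) = shiftK (-((N : ℤ) • t)) (M ρ w))
    (κ : Fin (d + 1)) (u : Site (d + 1)) (κ' α β : Fin (d + 1)) :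
    HasSum (fun u' : Site (d + 1) => ∑' x', ∑' z', mmRead N (comp (comp K (dM (K2OfK K N S M κ u) N S M κ' u')) K) x' z'
      (Sum.inl α) (Sum.inl β)) 0 := by
  have hC : 0 ≤ C := hK.nonneg (Sum.inl 0)
  have hCs : 0 ≤ Cs := (hS 0 0).nonneg (Sum.inl 0)
  have hCM : 0 ≤ CM := (hM 0 0).nonneg (Sum.inl 0)
  have hm8 : 0 < m / 8 := by positivity
  have hK2 : BiLoc (K2OfK K N S M κ u) ((N : ℤ) • u) ((N : ℤ) • u) (cK2 d C Cs CM m) (m / 8) := vertexFamily_K2OfK hK hC hm hS hM κ u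
  have hK8 : Decays K C (m / 8) := decays_mono hK hC le_rfl (by linarith)
  have hS8 : LocStencil S Cs (m / 8) := locStencil_mono hS hCs (by linarith)
  have hM8 : VertexFamily M N CM (m / 8) := fun ρ w => biLoc_mono (hM ρ w) hCM (by linarith)
  have hval : ∀ u' : Site (d + 1),
      (∑' x', ∑' z', mmRead N (comp (comp K (dM (K2OfK K N S M κ u) N S M κ' u')) K) x' z' (Sum.inl α) (Sum.inl β))
        = ∑ a : Fin (d + 1), ∑ b : Fin (d + 1), ρL α (Sum.inl a) * ρR β (Sum.inl b) *
            ∑ ρ : Fin (d + 1), (∑' w : Site (d + 1), colM (K2OfK K N S M κ u) N κ' u' ρ w) *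
              ∑' vp : Site (d + 1) × Site (d + 1), M ρ 0 vp.1 vp.2 (Sum.inl a) (Sum.inl b) :=
    fun u' => inner_readout_dM_of_biLoc hK8 hm8 hrow hcol hL0 hR0 hS8 hS0 hM8 hMt hK2 κ' u' α β
  have hcm : ∀ ρ : Fin (d + 1), HasSum (fun u' : Site (d + 1) => ∑' w : Site (d + 1), colM (K2OfK K N S M κ u) N κ' u' ρ w) 0 :=
    fun ρ => hasSum_colM_K2OfK_pos hK hm hrow hcol hL0 hR0 hS hS0 hM hMt κ u κ' ρ
  have h := hasSum_sum (s := (Finset.univ : Finset (Fin (d + 1)))) fun a _ =>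
    hasSum_sum (s := (Finset.univ : Finset (Fin (d + 1)))) fun b _ =>
      (hasSum_sum (s := (Finset.univ : Finset (Fin (d + 1)))) fun ρ _ =>
        (hcm ρ).mul_right (∑' vp : Site (d + 1) × Site (d + 1), M ρ 0 vp.1 vp.2 (Sum.inl a) (Sum.inl b))).mul_left
          (ρL α (Sum.inl a) * ρR β (Sum.inl b))
  simp only [zero_mul, Finset.sum_const_zero, mul_zero] at h
  exact h.congr_fun fun u' => (hval u').symm ▸ rfl

end Summit.QuantumFields.BalabanUV.Beta.GAN24.SecondResponseZeroMode

end
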